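import Summits.HodgeConjecture.HodgeConjecture.Theorems.H413MirrorAtPinLine                 -- ★ J-c: `MirrorAtPinLine.exists_conjPartner_omegaAtLine_neg` (the pin's conjugate partner)
import Summits.HodgeConjecture.HodgeConjecture.Theorems.H413ConjugatePartnerOfReprIndependence -- ★ `ConjugatePartner.bar_val_eq_setOf`; brings `AdmissibleElement`, `IdeleClassCharacterConjugate`
import Literature.NumberTheory.Automorphic.UnitaryGroupCohomologicalFormsConjRep             -- ★ `repConj`, `hasFinComponent_conj_repConj`, `isAntiholCotangentAt_iff_conj`
import Literature.NumberTheory.Rogawski1990.CohomologicalFinComponentIsTheta                -- ★ (C♭)-telescope vocabulary (`cmArchSection`, `cmCompactFactor`, …)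
import Literature.NumberTheory.Automorphic.Liu2021.Def411WeilCarriersAtLineFrameTransportOfIsometry  -- ★ frame independence `exists_omegaAtLine_equiv_rhoVAtLine_of_isometry`
import Literature.NumberTheory.Automorphic.Liu2021.Def411WeilCarriersAtLineReindex           -- ★ enumeration independence `exists_omegaAtLine_equiv_rhoVAtLine_reindex`
import Literature.NumberTheory.Automorphic.UnitaryGroupFrameHermitian                       -- ★ `cmConjRingHom_apply_eq_of_formCongr_eq_J`
import Literature.NumberTheory.Automorphic.UnitaryGroupFormCongrFinSum                      -- ★ `formCongr_mul_eq`
import Literature.NumberTheory.Automorphic.UnitaryGroupFormTransport                        -- ★ `formCongr_inv_formCongr`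
import Literature.AlgebraicGeometry.ShimuraVarieties.UnitaryBallRealPoints                  -- ★ `signatureMatrix_two`
import HarnessLib

/-!
# Crux `H413`, programme P2, rung 3 of E3♭∞ — **stub «conj»: the signed theta realisation of an ANTIHOLOMORPHIC cotangent form from the
# holomorphic statement, by complex conjugation** (`stubCSharpAntiholOfHol_holds : ‹StubCSharpHol› → ‹StubCSharpAntihol›`)

Cell hodgecm-mathlib (D-0151), FLOOR 0, crux item H413 = stmt-HodgeConjecture-24833, route of record `HCCMUnconditional`; programme P2, socket
27455 `F0HdictE`; rung-3 sub-line `Cruxes/H413/Lines/F0_P2E3Rung3.lean` v1 (809baa7acc4bedcc, F0P2-plan (g7), director s536 ∕ s538), registered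
stub `stub_CSharp_antihol_of_hol : StubCSharpHol → StubCSharpAntihol` (:553).  Author B-p18 (g27) (hand proposed by the pen 11:58:20Z).
THEOREMS ONLY (no `def`, no instance, no notation, no named fact, no `sorry`); `--supports stmt-HodgeConjecture-24833 --as helper`; imports NO
`Cruxes/…/Lines` module (O50-1): hypothesis = `StubCSharpHol` (:207–234) and conclusion = `StubCSharpAntihol` (:242–269) PASTED VERBATIM.
HC_CM is proved only modulo the printed citations until rung 0 closes; this file discharges no printed citation.

## The proof (in-house; every ingredient ★)
Given the (C♭) frame data `(L, ι, H, T, e₁, dV, g, ιV)` and a discrete automorphic `P` of ANTIHOLOMORPHIC cotangent type at `ι`: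
1. package `(H, T)` as a rank-3 CM hermitian space `V₀ : HodgeCM.HermSpace3 ⟨L⟩ ι` (★ `cmConjRingHom_apply_eq_of_formCongr_eq_J`, ★ `signatureMatrix_two`);
2. `P̄ = P.conj` is of HOLOMORPHIC cotangent type (★ `isAntiholCotangentAt_iff_conj`); the hypothesis (C♯)hol, applied to `P̄` AT THE PIN FRAME
   `(e₁⁰, frameD V₀, frameG V₀, ιVE V₀)` of `V₀` (★ `frame_congr`, ★ `coe_finFrameCongr`), gives `(μ, a, χ)` with `a·δ′` admissible for `Φ_μ` and
   `P̄_f ≅ ω(μ, ⟨a⟩, χ)`; hence `P = P̄̄` has finite component the CONJUGATE representation `\overline{ω(μ,⟨a⟩,χ)}` (★ `hasFinComponent_conj_repConj`);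
3. the pin's conjugate partner ★ `MirrorAtPinLine.exists_conjPartner_omegaAtLine_neg` [Liu2021, App. D Lem. D.1 (2)]: `\overline{ω(μ,⟨a⟩,χ)} ≅ ω(μ′, ⟨−a⟩, χ̄)`
   by a bijective conjugate-linear `U(V₀)(𝔸_f)`-map, `μ′` conjugate symplectic of weight one with `Φ_{μ′} = Φ̄_μ`;
4. back to the caller's frame: ★ enumeration independence (`e₁⁰ → e₁`) and ★ frame independence along the rational isometry `B = g⁻¹·frameG V₀`
   (`finAdelicCongr B ∘ ιVE V₀ = ιV`), so `P_f ≅ ω(μ′, ⟨−a⟩, χ̄)` in the frame `(e₁, dV, g, ιV)`;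
5. `(−a)·δ′ = −(a·δ′)` is admissible for `Φ̄_μ = Φ_{μ′}` (★ `isAdmissibleElement_conj_neg_iff`, ★ `IsConjugateSymplectic.cmType_eq`).

## References
* [Liu2021] Y. Liu, *Fourier–Jacobi cycles and arithmetic relative trace formula*, Camb. J. Math. 9 (2021) = arXiv:2102.11518: Def. 4.11–4.12,
  Rem. 4.4, Prop. 4.13 (proof, Case 1), App. D §D.1 Steps 1–3, Lem. D.1 (2), Rem. D.5.
* [BorelWallach2000] A. Borel, N. Wallach, *Continuous cohomology, discrete subgroups, and representations of reductive groups* (2000), VII 2.10, 3.2.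
* [Clozel1990] L. Clozel, *Motifs et formes automorphes*, in: Automorphic forms, Shimura varieties, and L-functions I (1990), §3.1.
* [GelbartRogawski1991] S. Gelbart, J. Rogawski, Invent. Math. 105 (1991), §3.1 Prop. 3.1.1 p. 455, Remark p. 457.
* [PlatonovRapinchuk1994] V. Platonov, A. Rapinchuk, *Algebraic groups and number theory* (1994), §2.3, §5.1.
-/

set_option autoImplicit false
-- the mandated namespace has the single-problem summit's repeated segment (`HodgeConjecture.HodgeConjecture`)
set_option linter.dupNamespace false

noncomputable section

namespace Summit.HodgeConjecture.HodgeConjecture.Cruxes.H413.F0P2mCSharpAntiholOfHol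

open scoped Matrix ComplexOrder ComplexConjugate
open NumberField NumberField.InfinitePlace IsDedekindDomain MeasureTheory
open Literature.NumberTheory Literature.NumberTheory.Automorphic Literature.NumberTheory.Automorphic.UnitaryGroup
open Literature.NumberTheory.Automorphic.UnitaryGroup.CotangentForms
open Literature.NumberTheory.Automorphic.ConjVec
open Literature.NumberTheory.Automorphic.Liu2021 Literature.NumberTheory.Automorphic.Liu2021.AppendixC
open Literature.NumberTheory.Automorphic.Liu2021.Def411WeilCarriers
open Literature.NumberTheory.Automorphic.Liu2021.Def411WeilCarriersDoubling
open Literature.NumberTheory.Automorphic.IdeleClassGroup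
open Literature.NumberTheory.GelbartRogawski1991 Literature.NumberTheory.GelbartRogawski1991.UnitaryDualPair
open Literature.NumberTheory.GelbartRogawski1991.UnitaryDualPair.WeilCoinv
open Literature.RepresentationTheory Literature.RepresentationTheory.Liu2021
open Literature.NumberTheory.Rogawski1990
open Literature.NumberTheory.ComplexMultiplication.CMTypeOps (bar mem_bar_iff)
open Literature.AlgebraicGeometry.Liu2021 (IsAdmissibleElement isAdmissibleElement_conj_neg_iff)
open Summit.HodgeConjecture.CorCM
open Summit.HodgeConjecture.CorCM.Transposition
open Summit.HodgeConjecture.CorCM.Transposition.OmegaChiSplitting (sChiD hsChiD)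
open HodgeCM.Model HodgeCM.Model.LiuIndex
open HodgeCM.Model.ArchSideTerm (e₁)
open Summit.HodgeConjecture.HodgeConjecture.Cruxes.H413.MirrorAtPinLine (exists_conjPartner_omegaAtLine_neg)
open Summit.HodgeConjecture.HodgeConjecture.Cruxes.H413.ConjugatePartner (bar_val_eq_setOf)

/-! ## Two bookkeeping lemmas on inverting an equivariance -/

/-- if `Ψ` carries `T_A` to `T_B`, then `Ψ⁻¹` carries `T_B` to `T_A` (semilinear equivalences). [folklore] -/
private theorem symm_apply_comm {A B : Type*} [AddCommGroup A] [AddCommGroup B] [Module ℂ A] [Module ℂ B]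
    {σ σ' : ℂ →+* ℂ} [RingHomInvPair σ σ'] [RingHomInvPair σ' σ]
    (Ψ : A ≃ₛₗ[σ] B) (TA : A → A) (TB : B → B) (h : ∀ y, Ψ (TA y) = TB (Ψ y)) (x : B) :
    Ψ.symm (TB x) = TA (Ψ.symm x) := by
  apply Ψ.injective
  rw [LinearEquiv.apply_symm_apply, h, LinearEquiv.apply_symm_apply]

/-- the same for a bijective semilinear MAP, inverted through `LinearEquiv.ofBijective`. [folklore] -/
private theorem ofBijective_symm_apply_comm {A B : Type*} [AddCommGroup A] [AddCommGroup B] [Module ℂ A] [Module ℂ B]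
    {σ σ' : ℂ →+* ℂ} [RingHomInvPair σ σ'] [RingHomInvPair σ' σ]
    (J : A →ₛₗ[σ] B) (hJ : Function.Bijective J) (TA : A → A) (TB : B → B) (h : ∀ y, J (TA y) = TB (J y)) (x : B) :
    (LinearEquiv.ofBijective J hJ).symm (TB x) = TA ((LinearEquiv.ofBijective J hJ).symm x) := by
  apply (LinearEquiv.ofBijective J hJ).injective
  have hx : J ((LinearEquiv.ofBijective J hJ).symm x) = x := (LinearEquiv.ofBijective J hJ).apply_symm_apply x
  rw [LinearEquiv.apply_symm_apply, LinearEquiv.ofBijective_apply, h, hx]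

/-! ## The stub -/

set_option synthInstance.maxHeartbeats 400000 in
set_option maxHeartbeats 16000000 in
/-- **stub «conj» — (C♯)antihol from (C♯)hol by complex conjugation** (hypothesis `StubCSharpHol` and conclusion `StubCSharpAntihol` of the rung-3
sub-line `Lines/F0_P2E3Rung3.lean` v1 :207–234 ∕ :242–269, VERBATIM).  `P` antiholomorphic cotangent ⇒ `P̄` holomorphic cotangent
(★ `isAntiholCotangentAt_iff_conj`) ⇒ (C♯)hol at the pin frame of `V₀ = (H, T)` gives `P̄_f ≅ ω(μ,⟨a⟩,χ)` with `a·δ′` admissible for `Φ_μ` ⇒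
`P_f ≅ \overline{ω(μ,⟨a⟩,χ)}` (★ `hasFinComponent_conj_repConj`) `≅ ω(μ′,⟨−a⟩,χ̄)` (★ J-c `exists_conjPartner_omegaAtLine_neg`, `Φ_{μ′} = Φ̄_μ`) read in
the caller's frame by ★ enumeration and ★ frame independence; `(−a)·δ′ = −(a·δ′)` is admissible for `Φ̄_μ` (★ `isAdmissibleElement_conj_neg_iff`).
[cite: Liu2021, App. D Lem. D.1 (2), Rem. D.5, Def. 4.12 (last sentence), Rem. 4.4] [cite: BorelWallach2000, VII 2.10, 3.2] [cite: Clozel1990, §3.1] -/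
theorem stubCSharpAntiholOfHol_holds
    (hH :
  ∀ (L : Type) [Field L] [NumberField L] [IsCMField L] (ι : L →+* ℂ) (H : Matrix (Fin 3) (Fin 3) L) (T : GL (Fin 3) ℂ)
    (hT : (T : Matrix (Fin 3) (Fin 3) ℂ)ᴴ * H.map ι * (T : Matrix (Fin 3) (Fin 3) ℂ) = Literature.Geometry.ComplexHyperbolic.BallModel.J),
    (∀ τ' : L →+* ℂ, InfinitePlace.mk τ' ≠ InfinitePlace.mk ι → (H.map τ').PosDef) → 2 ≤ Module.finrank ℚ ↥(maximalRealSubfield L) →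
    ∀ {n' : ℕ} (e₁ : Fin 3 × Fin 1 ≃ Fin n') (dV : Fin 3 → L) (hdV : ∀ i, IsCMField.complexConj L (dV i) = dV i)
      (hdV0 : ∀ i, dV i ≠ 0) (g : GL (Fin 3) L)
      (hg : ((g : Matrix (Fin 3) (Fin 3) L).map (cmConjRingHom L))ᵀ * H * (g : Matrix (Fin 3) (Fin 3) L) = Matrix.diagonal dV)
      (ιV : finAdelic (↥(maximalRealSubfield L)) L (IsCMField.complexConj L) 3 H →*
          finAdelic (↥(maximalRealSubfield L)) L (IsCMField.complexConj L) 3 (Matrix.diagonal dV)),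
        (∀ k, ((ιV k : finAdelic (↥(maximalRealSubfield L)) L (IsCMField.complexConj L) 3 (Matrix.diagonal dV)) :
            GL (Fin 3) (FiniteAdeleRing (𝓞 L) L)) =
          (toFinAdeleGL L 3 g)⁻¹ * (k : GL (Fin 3) (FiniteAdeleRing (𝓞 L) L)) * toFinAdeleGL L 3 g) →
        ∀ (μA : Measure (adelicGroupData (↥(maximalRealSubfield L)) L (IsCMField.complexConj L) 3 H).automorphicQuotient)
          [(adelicGroupData (↥(maximalRealSubfield L)) L (IsCMField.complexConj L) 3 H).IsAutomorphicMeasure μA],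
          ∀ P : DiscreteAutomorphicRep (adelicGroupData (↥(maximalRealSubfield L)) L (IsCMField.complexConj L) 3 H) μA,
            P.IsHolCotangentAt (cmArchSection L ι H T hT) (cmCompactFactor L ι H T hT) →
              ∃ (μ : Literature.NumberTheory.Automorphic.IdeleClassGroup L →ₜ* Circle) (hμ : IsConjugateSymplectic L μ),
                HasWeight L μ 1 ∧
                ∃ (a : (↥(maximalRealSubfield L))ˣ) (χ : Chi (↥(maximalRealSubfield L)) L (IsCMField.complexConj L)),
                  IsAdmissibleElement L hμ.cmType.1 (algebraMap (↥(maximalRealSubfield L)) L a * (2 * imagUnit L)⁻¹) ∧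
                    P.HasFinComponent
                  (rhoAtLine (↥(maximalRealSubfield L)) L (IsCMField.complexConj L) 3 e₁ (Matrix.diagonal dV)
                    (complexConj_imagUnit L) (imagUnit_ne_zero L) (imagUnit_mul_self L) (realDiagonal_isSymm L dV hdV)
                    (isUnit_det_realDiagonal L dV hdV hdV0) (realDiagonal_map L dV hdV).symm
                    (fun a => isCompatible_chiSplittingLine L e₁ dV hdV hdV0 (toHeckeCharacter L μ)
                      (isUnitary_toHeckeCharacter L μ) ((isOscillatorChar_toHeckeCharacter_iff μ).mpr hμ)
                      (TW (↥(maximalRealSubfield L)) a) (isSymm_TW (↥(maximalRealSubfield L)) a)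
                      (isUnit_det_TW (↥(maximalRealSubfield L)) a) (JW (↥(maximalRealSubfield L)) L a)
                      (JW_eq (↥(maximalRealSubfield L)) L a)) ιV a χ)
) :
  ∀ (L : Type) [Field L] [NumberField L] [IsCMField L] (ι : L →+* ℂ) (H : Matrix (Fin 3) (Fin 3) L) (T : GL (Fin 3) ℂ)
    (hT : (T : Matrix (Fin 3) (Fin 3) ℂ)ᴴ * H.map ι * (T : Matrix (Fin 3) (Fin 3) ℂ) = Literature.Geometry.ComplexHyperbolic.BallModel.J),
    (∀ τ' : L →+* ℂ, InfinitePlace.mk τ' ≠ InfinitePlace.mk ι → (H.map τ').PosDef) → 2 ≤ Module.finrank ℚ ↥(maximalRealSubfield L) →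
    ∀ {n' : ℕ} (e₁ : Fin 3 × Fin 1 ≃ Fin n') (dV : Fin 3 → L) (hdV : ∀ i, IsCMField.complexConj L (dV i) = dV i)
      (hdV0 : ∀ i, dV i ≠ 0) (g : GL (Fin 3) L)
      (hg : ((g : Matrix (Fin 3) (Fin 3) L).map (cmConjRingHom L))ᵀ * H * (g : Matrix (Fin 3) (Fin 3) L) = Matrix.diagonal dV)
      (ιV : finAdelic (↥(maximalRealSubfield L)) L (IsCMField.complexConj L) 3 H →*
          finAdelic (↥(maximalRealSubfield L)) L (IsCMField.complexConj L) 3 (Matrix.diagonal dV)),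
        (∀ k, ((ιV k : finAdelic (↥(maximalRealSubfield L)) L (IsCMField.complexConj L) 3 (Matrix.diagonal dV)) :
            GL (Fin 3) (FiniteAdeleRing (𝓞 L) L)) =
          (toFinAdeleGL L 3 g)⁻¹ * (k : GL (Fin 3) (FiniteAdeleRing (𝓞 L) L)) * toFinAdeleGL L 3 g) →
        ∀ (μA : Measure (adelicGroupData (↥(maximalRealSubfield L)) L (IsCMField.complexConj L) 3 H).automorphicQuotient)
          [(adelicGroupData (↥(maximalRealSubfield L)) L (IsCMField.complexConj L) 3 H).IsAutomorphicMeasure μA],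
          ∀ P : DiscreteAutomorphicRep (adelicGroupData (↥(maximalRealSubfield L)) L (IsCMField.complexConj L) 3 H) μA,
            P.IsAntiholCotangentAt (cmArchSection L ι H T hT) (cmCompactFactor L ι H T hT) →
              ∃ (μ : Literature.NumberTheory.Automorphic.IdeleClassGroup L →ₜ* Circle) (hμ : IsConjugateSymplectic L μ),
                HasWeight L μ 1 ∧
                ∃ (a : (↥(maximalRealSubfield L))ˣ) (χ : Chi (↥(maximalRealSubfield L)) L (IsCMField.complexConj L)),
                  IsAdmissibleElement L hμ.cmType.1 (algebraMap (↥(maximalRealSubfield L)) L a * (2 * imagUnit L)⁻¹) ∧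
                    P.HasFinComponent
                  (rhoAtLine (↥(maximalRealSubfield L)) L (IsCMField.complexConj L) 3 e₁ (Matrix.diagonal dV)
                    (complexConj_imagUnit L) (imagUnit_ne_zero L) (imagUnit_mul_self L) (realDiagonal_isSymm L dV hdV)
                    (isUnit_det_realDiagonal L dV hdV hdV0) (realDiagonal_map L dV hdV).symm
                    (fun a => isCompatible_chiSplittingLine L e₁ dV hdV hdV0 (toHeckeCharacter L μ)
                      (isUnitary_toHeckeCharacter L μ) ((isOscillatorChar_toHeckeCharacter_iff μ).mpr hμ)
                      (TW (↥(maximalRealSubfield L)) a) (isSymm_TW (↥(maximalRealSubfield L)) a)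
                      (isUnit_det_TW (↥(maximalRealSubfield L)) a) (JW (↥(maximalRealSubfield L)) L a)
                      (JW_eq (↥(maximalRealSubfield L)) L a)) ιV a χ) := by
  intro L _ _ _ ι H T hT hpos h2 n' e₁' dV hdV hdV0 g hg ιV hιV μA _ P hP
  -- (1) the rank-3 CM hermitian space `V₀ = (H, T)` over the bundled CM field `⟨L⟩`
  obtain ⟨V₀, hV₀⟩ : ∃ V₀ : HodgeCM.HermSpace3 (⟨L⟩ : HodgeCM.CMField) ι, HodgeCM.HermSpace3.Hm V₀ = H :=
    ⟨⟨H, fun i j => cmConjRingHom_apply_eq_of_formCongr_eq_J L H ι T (formCongr_eq_of_conjTranspose L ι H T hT) i j,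
      ⟨T, by rw [Literature.AlgebraicGeometry.ShimuraVarieties.UnitaryBallUniformisationDatum.signatureMatrix_two]; exact hT⟩, hpos⟩, rfl⟩
  subst hV₀
  -- (2) `P̄` is holomorphic cotangent; (C♯)hol at the PIN FRAME `(e₁⁰, frameD V₀, frameG V₀, ιVE V₀)`
  have hPc : P.conj.IsHolCotangentAt (cmArchSection L ι (HodgeCM.HermSpace3.Hm V₀) T hT)
      (cmCompactFactor L ι (HodgeCM.HermSpace3.Hm V₀) T hT) :=
    (isAntiholCotangentAt_iff_conj P _ _).mp hP
  obtain ⟨μ, hμ, hw, a, χ, hadm, hfc⟩ := hH L ι (HodgeCM.HermSpace3.Hm V₀) T hT hpos h2 e₁ (frameD V₀) (frameD_real V₀)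
    (frameD_ne V₀) (frameG V₀) (frame_congr V₀) (ιVE V₀)
    (fun k => coe_finFrameCongr L (HodgeCM.HermSpace3.Hm V₀) (frameG V₀) (frameD V₀) (frame_congr V₀) k) μA P.conj hPc
  -- (3) `P = P̄̄` has finite component the CONJUGATE representation
  have hfc' := hasFinComponent_conj_repConj P.conj hfc
  rw [DiscreteAutomorphicRep.conj_conj] at hfc'
  -- (4) the pin's conjugate partner `μ′`, `J : ω(μ,⟨a⟩,χ) → ω(μ′,⟨−a⟩,χ̄)` (conjugate-linear, bijective, equivariant)
  obtain ⟨μ', hμ', hw', hΦ', J, hJb, hJeq⟩ := exists_conjPartner_omegaAtLine_neg V₀ μ hμ hw hμ.hasCMType_cmType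
    ((isOscillatorChar_toHeckeCharacter_iff μ).mpr hμ) a χ
  have hcm' : hμ'.cmType = bar hμ.cmType := hμ'.cmType_eq hΦ'
  -- the conjugate character `χ̄ := ⟨conj ∘ χ, _⟩ ∈ Chi` is written out at each use (no local abbreviation)
  refine ⟨μ', hμ', hw', -a, ⟨(Units.map ((starRingEnd ℂ : ℂ →+* ℂ) : ℂ →* ℂ)).comp χ.1,
      isAutomorphicOneChar_unitsMap_comp_chi (IsCMField.complexConj L) χ _⟩, ?_, ?_⟩
  · -- (5) `(−a)·δ′ = −(a·δ′)` is admissible for `Φ_{μ′} = Φ̄_μ`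
    rw [hcm', bar_val_eq_setOf, Units.val_neg, map_neg, neg_mul]
    exact (isAdmissibleElement_conj_neg_iff _ _).2 hadm
  · -- (6) transport `ω(μ′,⟨−a⟩,χ̄)` from the pin frame `(e₁⁰, frameD V₀, ιVE V₀)` to the caller's frame `(e₁, dV, ιV)`
    -- (6a) enumeration independence at the pin frame: `e₁⁰ → e₁`
    obtain ⟨Ψ₁, -, hΨ₁⟩ := exists_omegaAtLine_equiv_rhoVAtLine_reindex L e₁ e₁' (frameD V₀) (frameD_real V₀) (frameD_ne V₀)
      (toHeckeCharacter L μ') (isUnitary_toHeckeCharacter L μ') ((isOscillatorChar_toHeckeCharacter_iff μ').mpr hμ') (-a) ⟨(Units.map ((starRingEnd ℂ : ℂ →+* ℂ) : ℂ →* ℂ)).comp χ.1,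
            isAutomorphicOneChar_unitsMap_comp_chi (IsCMField.complexConj L) χ _⟩
    -- (6b) frame independence along the rational isometry `B := g⁻¹ · frameG V₀` from `diag (frameD V₀)` to `diag dV`
    have hg' : formCongr ((IsCMField.complexConj L : L ≃ₐ[↥(maximalRealSubfield L)] L) : L →+* L) g
        (HodgeCM.HermSpace3.Hm V₀) = Matrix.diagonal dV := hg
    have hB : formCongr ((IsCMField.complexConj L : L ≃ₐ[↥(maximalRealSubfield L)] L) : L →+* L) (g⁻¹ * frameG V₀)
        ((1 : L) • Matrix.diagonal dV) = Matrix.diagonal (frameD V₀) := by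
      rw [one_smul, formCongr_mul_eq, ← hg', formCongr_inv_formCongr]
      exact frame_congr V₀
    obtain ⟨Ψ₂, hΨ₂⟩ := exists_omegaAtLine_equiv_rhoVAtLine_of_isometry L e₁' (frameD V₀) (frameD_real V₀) (frameD_ne V₀)
      dV hdV hdV0 (g⁻¹ * frameG V₀) hB (toHeckeCharacter L μ') (isUnitary_toHeckeCharacter L μ')
      ((isOscillatorChar_toHeckeCharacter_iff μ').mpr hμ') (-a) ⟨(Units.map ((starRingEnd ℂ : ℂ →+* ℂ) : ℂ →* ℂ)).comp χ.1,
            isAutomorphicOneChar_unitsMap_comp_chi (IsCMField.complexConj L) χ _⟩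
    -- (6c) the two frame transports agree on `U(H)(𝔸_f)`: `B_f (G_f⁻¹ k G_f) B_f⁻¹ = g_f⁻¹ k g_f`
    have hcong : ∀ k : finAdelic (↥(maximalRealSubfield L)) L (IsCMField.complexConj L) 3 (HodgeCM.HermSpace3.Hm V₀),
        finAdelicCongr (↥(maximalRealSubfield L)) L (IsCMField.complexConj L) (g⁻¹ * frameG V₀) one_ne_zero hB (ιVE V₀ k) =
          ιV k := by
      intro k
      apply Subtype.ext
      rw [coe_finAdelicCongr_apply, hιV k, coe_finFrameCongr, map_mul, map_inv, mul_inv_rev, inv_inv]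
      simp only [mul_assoc, mul_inv_cancel_left]
    have hΨ₂' : ∀ (k : finAdelic (↥(maximalRealSubfield L)) L (IsCMField.complexConj L) 3 (HodgeCM.HermSpace3.Hm V₀))
        (y : omegaAtLine (↥(maximalRealSubfield L)) L (IsCMField.complexConj L) 3 e₁' (Matrix.diagonal (frameD V₀))
          (complexConj_imagUnit L) (imagUnit_ne_zero L) (imagUnit_mul_self L) (realDiagonal_isSymm L (frameD V₀) (frameD_real V₀))
          (isUnit_det_realDiagonal L (frameD V₀) (frameD_real V₀) (frameD_ne V₀)) (realDiagonal_map L (frameD V₀) (frameD_real V₀)).symm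
          (fun a => isCompatible_chiSplittingLine L e₁' (frameD V₀) (frameD_real V₀) (frameD_ne V₀) (toHeckeCharacter L μ')
            (isUnitary_toHeckeCharacter L μ') ((isOscillatorChar_toHeckeCharacter_iff μ').mpr hμ')
            (TW (↥(maximalRealSubfield L)) a) (isSymm_TW (↥(maximalRealSubfield L)) a) (isUnit_det_TW (↥(maximalRealSubfield L)) a) (JW (↥(maximalRealSubfield L)) L a) (JW_eq (↥(maximalRealSubfield L)) L a)) (-a) ⟨(Units.map ((starRingEnd ℂ : ℂ →+* ℂ) : ℂ →* ℂ)).comp χ.1,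
            isAutomorphicOneChar_unitsMap_comp_chi (IsCMField.complexConj L) χ _⟩),
        Ψ₂ (rhoVAtLine (↥(maximalRealSubfield L)) L (IsCMField.complexConj L) 3 e₁' (Matrix.diagonal (frameD V₀))
          (complexConj_imagUnit L) (imagUnit_ne_zero L) (imagUnit_mul_self L) (realDiagonal_isSymm L (frameD V₀) (frameD_real V₀))
          (isUnit_det_realDiagonal L (frameD V₀) (frameD_real V₀) (frameD_ne V₀)) (realDiagonal_map L (frameD V₀) (frameD_real V₀)).symm
          (fun a => isCompatible_chiSplittingLine L e₁' (frameD V₀) (frameD_real V₀) (frameD_ne V₀) (toHeckeCharacter L μ')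
            (isUnitary_toHeckeCharacter L μ') ((isOscillatorChar_toHeckeCharacter_iff μ').mpr hμ')
            (TW (↥(maximalRealSubfield L)) a) (isSymm_TW (↥(maximalRealSubfield L)) a) (isUnit_det_TW (↥(maximalRealSubfield L)) a) (JW (↥(maximalRealSubfield L)) L a) (JW_eq (↥(maximalRealSubfield L)) L a)) (-a) ⟨(Units.map ((starRingEnd ℂ : ℂ →+* ℂ) : ℂ →* ℂ)).comp χ.1,
            isAutomorphicOneChar_unitsMap_comp_chi (IsCMField.complexConj L) χ _⟩ (ιVE V₀ k) y) =
          rhoVAtLine (↥(maximalRealSubfield L)) L (IsCMField.complexConj L) 3 e₁' (Matrix.diagonal dV)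
          (complexConj_imagUnit L) (imagUnit_ne_zero L) (imagUnit_mul_self L) (realDiagonal_isSymm L dV hdV)
          (isUnit_det_realDiagonal L dV hdV hdV0) (realDiagonal_map L dV hdV).symm
          (fun a => isCompatible_chiSplittingLine L e₁' dV hdV hdV0 (toHeckeCharacter L μ')
            (isUnitary_toHeckeCharacter L μ') ((isOscillatorChar_toHeckeCharacter_iff μ').mpr hμ')
            (TW (↥(maximalRealSubfield L)) a) (isSymm_TW (↥(maximalRealSubfield L)) a) (isUnit_det_TW (↥(maximalRealSubfield L)) a) (JW (↥(maximalRealSubfield L)) L a) (JW_eq (↥(maximalRealSubfield L)) L a)) (-a) ⟨(Units.map ((starRingEnd ℂ : ℂ →+* ℂ) : ℂ →* ℂ)).comp χ.1,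
            isAutomorphicOneChar_unitsMap_comp_chi (IsCMField.complexConj L) χ _⟩ (ιV k) (Ψ₂ y) := by
      intro k y
      rw [hΨ₂, hcong]
    -- (6d) `J` READ ON THE `isCompatible_chiSplittingLine`-typed carriers over `L` (definitional: `sChiD` unfolds, `⟨L⟩.K = L`)
    have hJc : ∃ Jc : omegaAtLine (↥(maximalRealSubfield L)) L (IsCMField.complexConj L) 3 e₁ (Matrix.diagonal (frameD V₀))
          (complexConj_imagUnit L) (imagUnit_ne_zero L) (imagUnit_mul_self L) (realDiagonal_isSymm L (frameD V₀) (frameD_real V₀))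
          (isUnit_det_realDiagonal L (frameD V₀) (frameD_real V₀) (frameD_ne V₀)) (realDiagonal_map L (frameD V₀) (frameD_real V₀)).symm
          (fun a => isCompatible_chiSplittingLine L e₁ (frameD V₀) (frameD_real V₀) (frameD_ne V₀) (toHeckeCharacter L μ)
            (isUnitary_toHeckeCharacter L μ) ((isOscillatorChar_toHeckeCharacter_iff μ).mpr hμ)
            (TW (↥(maximalRealSubfield L)) a) (isSymm_TW (↥(maximalRealSubfield L)) a) (isUnit_det_TW (↥(maximalRealSubfield L)) a) (JW (↥(maximalRealSubfield L)) L a) (JW_eq (↥(maximalRealSubfield L)) L a)) a χ →ₛₗ[starRingEnd ℂ]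
        omegaAtLine (↥(maximalRealSubfield L)) L (IsCMField.complexConj L) 3 e₁ (Matrix.diagonal (frameD V₀))
          (complexConj_imagUnit L) (imagUnit_ne_zero L) (imagUnit_mul_self L) (realDiagonal_isSymm L (frameD V₀) (frameD_real V₀))
          (isUnit_det_realDiagonal L (frameD V₀) (frameD_real V₀) (frameD_ne V₀)) (realDiagonal_map L (frameD V₀) (frameD_real V₀)).symm
          (fun a => isCompatible_chiSplittingLine L e₁ (frameD V₀) (frameD_real V₀) (frameD_ne V₀) (toHeckeCharacter L μ')
            (isUnitary_toHeckeCharacter L μ') ((isOscillatorChar_toHeckeCharacter_iff μ').mpr hμ')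
            (TW (↥(maximalRealSubfield L)) a) (isSymm_TW (↥(maximalRealSubfield L)) a) (isUnit_det_TW (↥(maximalRealSubfield L)) a) (JW (↥(maximalRealSubfield L)) L a) (JW_eq (↥(maximalRealSubfield L)) L a)) (-a) ⟨(Units.map ((starRingEnd ℂ : ℂ →+* ℂ) : ℂ →* ℂ)).comp χ.1,
            isAutomorphicOneChar_unitsMap_comp_chi (IsCMField.complexConj L) χ _⟩,
        Function.Bijective Jc ∧
        ∀ (k : finAdelic (↥(maximalRealSubfield L)) L (IsCMField.complexConj L) 3 (Matrix.diagonal (frameD V₀)))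
          (y : omegaAtLine (↥(maximalRealSubfield L)) L (IsCMField.complexConj L) 3 e₁ (Matrix.diagonal (frameD V₀))
          (complexConj_imagUnit L) (imagUnit_ne_zero L) (imagUnit_mul_self L) (realDiagonal_isSymm L (frameD V₀) (frameD_real V₀))
          (isUnit_det_realDiagonal L (frameD V₀) (frameD_real V₀) (frameD_ne V₀)) (realDiagonal_map L (frameD V₀) (frameD_real V₀)).symm
          (fun a => isCompatible_chiSplittingLine L e₁ (frameD V₀) (frameD_real V₀) (frameD_ne V₀) (toHeckeCharacter L μ)
            (isUnitary_toHeckeCharacter L μ) ((isOscillatorChar_toHeckeCharacter_iff μ).mpr hμ)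
            (TW (↥(maximalRealSubfield L)) a) (isSymm_TW (↥(maximalRealSubfield L)) a) (isUnit_det_TW (↥(maximalRealSubfield L)) a) (JW (↥(maximalRealSubfield L)) L a) (JW_eq (↥(maximalRealSubfield L)) L a)) a χ),
          Jc (rhoVAtLine (↥(maximalRealSubfield L)) L (IsCMField.complexConj L) 3 e₁ (Matrix.diagonal (frameD V₀))
          (complexConj_imagUnit L) (imagUnit_ne_zero L) (imagUnit_mul_self L) (realDiagonal_isSymm L (frameD V₀) (frameD_real V₀))
          (isUnit_det_realDiagonal L (frameD V₀) (frameD_real V₀) (frameD_ne V₀)) (realDiagonal_map L (frameD V₀) (frameD_real V₀)).symm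
          (fun a => isCompatible_chiSplittingLine L e₁ (frameD V₀) (frameD_real V₀) (frameD_ne V₀) (toHeckeCharacter L μ)
            (isUnitary_toHeckeCharacter L μ) ((isOscillatorChar_toHeckeCharacter_iff μ).mpr hμ)
            (TW (↥(maximalRealSubfield L)) a) (isSymm_TW (↥(maximalRealSubfield L)) a) (isUnit_det_TW (↥(maximalRealSubfield L)) a) (JW (↥(maximalRealSubfield L)) L a) (JW_eq (↥(maximalRealSubfield L)) L a)) a χ k y) =
            rhoVAtLine (↥(maximalRealSubfield L)) L (IsCMField.complexConj L) 3 e₁ (Matrix.diagonal (frameD V₀))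
          (complexConj_imagUnit L) (imagUnit_ne_zero L) (imagUnit_mul_self L) (realDiagonal_isSymm L (frameD V₀) (frameD_real V₀))
          (isUnit_det_realDiagonal L (frameD V₀) (frameD_real V₀) (frameD_ne V₀)) (realDiagonal_map L (frameD V₀) (frameD_real V₀)).symm
          (fun a => isCompatible_chiSplittingLine L e₁ (frameD V₀) (frameD_real V₀) (frameD_ne V₀) (toHeckeCharacter L μ')
            (isUnitary_toHeckeCharacter L μ') ((isOscillatorChar_toHeckeCharacter_iff μ').mpr hμ')
            (TW (↥(maximalRealSubfield L)) a) (isSymm_TW (↥(maximalRealSubfield L)) a) (isUnit_det_TW (↥(maximalRealSubfield L)) a) (JW (↥(maximalRealSubfield L)) L a) (JW_eq (↥(maximalRealSubfield L)) L a)) (-a) ⟨(Units.map ((starRingEnd ℂ : ℂ →+* ℂ) : ℂ →* ℂ)).comp χ.1,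
            isAutomorphicOneChar_unitsMap_comp_chi (IsCMField.complexConj L) χ _⟩ k (Jc y) :=
      ⟨J, hJb, hJeq⟩
    obtain ⟨Jc, hJcb, hJc⟩ := hJc
    clear hJeq hJb J
    -- (6e) the injective intertwiner `ω_{dV,e₁}(μ′,⟨−a⟩,χ̄)∘ιV → P_f`: `f ∘ toConj ∘ J⁻¹ ∘ Ψ₁⁻¹ ∘ Ψ₂⁻¹`
    obtain ⟨f, hf⟩ := hfc'
    let θ := (toConj (V := _)).toLinearMap.comp (LinearEquiv.ofBijective Jc hJcb).symm.toLinearMap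
    have hθ : ∀ z, θ z = toConj ((LinearEquiv.ofBijective Jc hJcb).symm z) := fun z => rfl
    let φ := f.toLinearMap ∘ₗ θ ∘ₗ Ψ₁.symm.toLinearMap ∘ₗ Ψ₂.symm.toLinearMap
    have hφ : ∀ x, φ x = f (θ (Ψ₁.symm (Ψ₂.symm x))) := fun x => rfl
    refine ⟨LinearMap.intertwiningMap_of_isIntertwiningMap _ _ φ (fun k x => ?_), ?_⟩
    · -- equivariance
      rw [hφ, hφ, ← Representation.IntertwiningMap.isIntertwining, rhoAtLine_apply,
        symm_apply_comm Ψ₂ _ _ (hΨ₂' k) x, symm_apply_comm Ψ₁ _ _ (hΨ₁ (ιVE V₀ k)), hθ, hθ,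
        ofBijective_symm_apply_comm Jc hJcb _ _ (hJc (ιVE V₀ k)), ← repConj_apply_toConj]
      rfl
    · -- injectivity
      intro x x' hxx'
      have h1 : φ x = φ x' := hxx'
      rw [hφ, hφ] at h1
      exact Ψ₂.symm.injective (Ψ₁.symm.injective ((toConj (V := _)).injective.comp
        (LinearEquiv.ofBijective Jc hJcb).symm.injective (hf h1)))

end Summit.HodgeConjecture.HodgeConjecture.Cruxes.H413.F0P2mCSharpAntiholOfHol

end
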